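import Literature.MathematicalPhysics.QuantumLattice.KomaTasakiSSB
import Mathlib.Analysis.InnerProductSpace.PiL2
import HarnessLib

/-!
# Barrier `SourcedOrderWithoutGroundStateLRO`, class-level witness: Koma–Tasaki's `U(1)` axioms admit a low-lying LRO eigenstate over an order-free unique ground state (vanishing-field spins)

Companion to `Literature/Barriers/HubbardSuperconductivity/SourcedOrderWithoutGroundStateLRO.lean` (barrier
catalogue, D-0021).  That entry renders Lieb–Seiringer–Yngvason's abstract profile ("it is a priori possible that
BEC only shows up after introducing an explicit gauge-breaking term", Rep. Math. Phys. 59 (2007) 389, §3) by a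
three-level system.  This file proves the sharper, CLASS-LEVEL statement announced there: the separation already
occurs INSIDE the abstract framework of T. Koma, H. Tasaki, J. Stat. Phys. 76 (1994) 745, §2.3 — the structure
`Literature.MathematicalPhysics.QuantumLattice.KomaTasaki.U1System` of `KomaTasakiSSB.lean` (local Hamiltonians
`h_x`, order densities `o^{(α)}_x`, charge `C`, commutation relations (2.12)–(2.14), locality i)–ii) with range
`r`, norm bounds iii) `‖h_x‖ ≤ h`, `‖o_x‖ ≤ o`) — with constants `h, o, r` that do NOT depend on the volume.

## The witness (N independent spins in the field `1/N`)

`Λ = Fin N`, `E = ℓ²({↑,↓}^N)` (`EuclideanSpace ℂ (Fin N → Bool)`), `h_x = N⁻¹ S^z_x`, `o^{(1)}_x = S^x_x`,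
`o^{(2)}_x = S^y_x`, `C = Σ_x S^z_x`, `S_x = {x}`, `r = 2`, `h = o = 1/2` (`spinSystem N`; every field of
`U1System` is verified, in particular the on-site `su(2)` relations give (2.14)).  Then, for `N = 2m`
(`komaTasakiClass_lowLyingLRO_without_groundStateLRO`):
* the ground energy is `−1/2`, the ground state is UNIQUE (`|⇓⟩`, `eq_smul_basisVec_down_of_ground`) and has
  `⟨(O^{(1)})²⟩ = N/4 = o²N` — no long-range order at any `μ > 0` once `N > μ⁻²`
  (`inner_order_zero_sq_basisVec_down`);
* the normalised Dicke vector of the sector `C = 0` is an eigenstate of `H` with eigenvalue `0` — excitation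
  energy exactly `1/2`, so zero excess energy DENSITY — and satisfies KT's hypothesis iv) (2.17) verbatim:
  `IsLROEigenstate (spinSystem N) Φ 0 (1/2)` (`isLROEigenstate_dickeState`; the needed binomial identity
  `(m+1)·#{numUp = m+1} = m·#{numUp = m}` is obtained from the symmetry of `O^{(1)}` and the ladder identity
  `sum_flipOp_dicke`, without binomial coefficients);
* the product vector `|⇒⟩` (all spins along `+x`) has `⟨H⟩ = 0` and `O^{(1)}|⇒⟩ = (N/2)|⇒⟩`
  (`inner_hamiltonian_ones`, `order_zero_ones`): under the symmetry-breaking field `−B O^{(1)}` of KT §2.4 the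
  ground energy is `≤ −BN/2 = E_N(0) − (BN/2 − 1/2)`, a linear gain with volume threshold `N ≥ 1/B`, and the
  field-then-volume order parameter is the maximal `o = 1/2` — symmetry breaking in KT's sense with an order-free
  symmetric floor at every `N`.
Hence Koma–Tasaki's Theorems 2.2–2.5 (which hold for this system) cannot be complemented, inside their own axioms,
by the converse "low-lying / sourced order ⇒ ground-state LRO": any such theorem must use that the interaction does
not depend on `N` (here the field `1/N` does), which is exactly the hypothesis no available method exploits for
lattice fermions at `T = 0` (see the barrier entry's `status`/`scope_caveats`).  What is NOT claimed: nothing here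
is a counterexample for a fixed translation-invariant finite-range interaction; the uniform field `1/N` is the
lattice form of LSY's weight profile.

## Sources

* T. Koma, H. Tasaki, J. Stat. Phys. 76 (1994) 745–803, arXiv:cond-mat/9708132 (`KomaTasaki1994`): §2.3
  (2.12)–(2.17) i)–iv) (the axioms instantiated here), §2.5 ("we are only able to prove the one sided inequality
  `μ₁ ≥ μ₂`").
* E. H. Lieb, R. Seiringer, J. Yngvason, Rep. Math. Phys. 59 (2007) 389–399, arXiv:math-ph/0610034
  (`LiebSeiringerYngvason2007`): §3, the abstract profile (junk5) and "a rigorous proof is lacking, so far".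
* H. Tasaki, J. Stat. Phys. 174 (2019) 735–761 (`Tasaki2019Tower`): §5 ("one probably should abandon the present
  general approach, and make use of specific properties [of] concrete models").

Mathlib/tree search: `EuclideanSpace`, `PiLp.inner_apply`, `ContinuousLinearMap.opNorm_le_bound`,
`LinearMap.IsSymmetric` (Mathlib); `U1System`, `IsLROEigenstate`, `U1System.isSymmetric_order` (tree,
`KomaTasakiSSB.lean`).  No spin-1/2 operator algebra on `ℓ²({↑,↓}^N)` exists in Mathlib or the tree (the tree's
lattice-fermion `Fock` is a different object); the operators are built here from two primitives, `diagOp` and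
`flipOp`, defined by their action on basis configurations.  Elementary; [folklore] throughout except where cited.
-/

noncomputable section

open Complex Finset
open scoped InnerProductSpace ComplexConjugate

namespace Literature.Barriers.HubbardSuperconductivity

namespace VanishingFieldSpins

variable {N : ℕ}

/-- Spin configurations on `N` sites (`true` = up). [folklore] -/
abbrev Cfg (N : ℕ) : Type := Fin N → Bool

/-- The `2^N`-dimensional spin space `ℓ²(Cfg N)`. [folklore] -/
abbrev Spins (N : ℕ) : Type := EuclideanSpace ℂ (Cfg N)

/-- Flip the spin at site `x`. [folklore] -/
def flipAt (x : Fin N) (σ : Cfg N) : Cfg N := Function.update σ x (!σ x)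

/-- The flipped configuration has the opposite bit at the flipped site. [folklore] -/
@[simp] theorem flipAt_apply_same (x : Fin N) (σ : Cfg N) : flipAt x σ x = !σ x := by
  simp [flipAt]

/-- Flipping at `x` does not change the other sites. [folklore] -/
theorem flipAt_apply_of_ne {x y : Fin N} (h : y ≠ x) (σ : Cfg N) : flipAt x σ y = σ y := by
  simp [flipAt, h]

/-- Flipping twice is the identity. [folklore] -/
@[simp] theorem flipAt_flipAt (x : Fin N) (σ : Cfg N) : flipAt x (flipAt x σ) = σ := by
  funext y
  by_cases h : y = x
  · subst h; simp
  · simp [flipAt_apply_of_ne h]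

/-- Flips at distinct sites commute. [folklore] -/
theorem flipAt_comm {x y : Fin N} (h : x ≠ y) (σ : Cfg N) :
    flipAt x (flipAt y σ) = flipAt y (flipAt x σ) := by
  funext z
  by_cases hzx : z = x
  · subst hzx
    simp [flipAt_apply_of_ne h]
  · by_cases hzy : z = y
    · subst hzy
      simp [flipAt_apply_of_ne (Ne.symm h)]
    · simp [flipAt_apply_of_ne hzx, flipAt_apply_of_ne hzy]

/-- Flipping at `x` is an involution of the configuration space. [folklore] -/
def flipEquiv (x : Fin N) : Cfg N ≃ Cfg N where
  toFun := flipAt x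
  invFun := flipAt x
  left_inv := flipAt_flipAt x
  right_inv := flipAt_flipAt x

/-- Unfolding of `flipEquiv`. [folklore] -/
@[simp] theorem flipEquiv_apply (x : Fin N) (σ : Cfg N) : flipEquiv x σ = flipAt x σ := rfl

/-- Site-diagonal operator with symbol `s` (value `s (σ x)` on the basis state `σ`). [folklore] -/
def diagOp (x : Fin N) (s : Bool → ℂ) : Spins N →L[ℂ] Spins N :=
  LinearMap.toContinuousLinearMap
    { toFun := fun ψ => (WithLp.equiv 2 _).symm (fun σ => s (σ x) * ψ σ)
      map_add' := fun ψ φ => by ext σ; simp [mul_add]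
      map_smul' := fun c ψ => by ext σ; simp; ring }

/-- Site-flip operator with coefficient `a` read off the target bit: `(T ψ)(σ) = a (σ x) ψ(flip_x σ)`.
[folklore] -/
def flipOp (x : Fin N) (a : Bool → ℂ) : Spins N →L[ℂ] Spins N :=
  LinearMap.toContinuousLinearMap
    { toFun := fun ψ => (WithLp.equiv 2 _).symm (fun σ => a (σ x) * ψ (flipAt x σ))
      map_add' := fun ψ φ => by ext σ; simp [mul_add]
      map_smul' := fun c ψ => by ext σ; simp; ring }

/-- Action of a diagonal operator in coordinates. [folklore] -/
@[simp] theorem diagOp_apply (x : Fin N) (s : Bool → ℂ) (ψ : Spins N) (σ : Cfg N) :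
    diagOp x s ψ σ = s (σ x) * ψ σ := by
  simp [diagOp]

/-- Action of a flip operator in coordinates. [folklore] -/
@[simp] theorem flipOp_apply (x : Fin N) (a : Bool → ℂ) (ψ : Spins N) (σ : Cfg N) :
    flipOp x a ψ σ = a (σ x) * ψ (flipAt x σ) := by
  simp [flipOp]

/-- Diagonal operators commute. [folklore] -/
theorem diagOp_mul_diagOp_comm (x y : Fin N) (s t : Bool → ℂ) :
    diagOp x s * diagOp y t = diagOp y t * diagOp x s := by
  ext ψ σ
  simp only [mul_apply_eq_comp, diagOp_apply]
  ring

/-- Flip operators at distinct sites commute. [folklore] -/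
theorem flipOp_mul_flipOp_comm {x y : Fin N} (h : x ≠ y) (a b : Bool → ℂ) :
    flipOp x a * flipOp y b = flipOp y b * flipOp x a := by
  ext ψ σ
  simp only [mul_apply_eq_comp, flipOp_apply, flipAt_apply_of_ne h,
    flipAt_apply_of_ne (Ne.symm h), flipAt_comm h]
  ring

/-- A flip operator commutes with a diagonal operator at a different site. [folklore] -/
theorem flipOp_mul_diagOp_comm {x y : Fin N} (h : x ≠ y) (a s : Bool → ℂ) :
    flipOp x a * diagOp y s = diagOp y s * flipOp x a := by
  ext ψ σ
  simp only [mul_apply_eq_comp, flipOp_apply, diagOp_apply, flipAt_apply_of_ne (Ne.symm h)]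
  ring

/-- Same-site commutator of a flip operator with a diagonal operator. [folklore] -/
theorem flipOp_mul_diagOp_sub (x : Fin N) (a s : Bool → ℂ) :
    flipOp x a * diagOp x s - diagOp x s * flipOp x a = flipOp x (fun b => a b * (s (!b) - s b)) := by
  ext ψ σ
  simp only [sub_apply, mul_apply_eq_comp]
  rw [PiLp.sub_apply]
  simp only [flipOp_apply, diagOp_apply, flipAt_apply_same]
  ring

/-- Inner products on the spin space, coordinatewise. [folklore] -/
theorem inner_eq_sum (ψ φ : Spins N) : ⟪ψ, φ⟫_ℂ = ∑ σ, conj (ψ σ) * φ σ := by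
  rw [PiLp.inner_apply]
  exact Finset.sum_congr rfl fun σ _ => by rw [RCLike.inner_apply, mul_comm]

/-- A diagonal operator with real symbol is symmetric. [folklore] -/
theorem isSymmetric_diagOp (x : Fin N) {s : Bool → ℂ} (hs : ∀ b, conj (s b) = s b) :
    (diagOp x s : Spins N →ₗ[ℂ] Spins N).IsSymmetric := by
  intro ψ φ
  simp only [ContinuousLinearMap.coe_coe, inner_eq_sum, diagOp_apply, map_mul, hs]
  refine Finset.sum_congr rfl fun σ _ => ?_
  ring

/-- A flip operator whose coefficient satisfies `conj (a b) = a (!b)` is symmetric. [folklore] -/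
theorem isSymmetric_flipOp (x : Fin N) {a : Bool → ℂ} (ha : ∀ b, conj (a b) = a (!b)) :
    (flipOp x a : Spins N →ₗ[ℂ] Spins N).IsSymmetric := by
  intro ψ φ
  simp only [ContinuousLinearMap.coe_coe, inner_eq_sum, flipOp_apply, map_mul]
  rw [← Equiv.sum_comp (flipEquiv x)]
  refine Finset.sum_congr rfl fun σ _ => ?_
  simp only [flipEquiv_apply, flipAt_apply_same, flipAt_flipAt, ha, Bool.not_not]
  ring

/-- Norm of a vector of the spin space, coordinatewise. [folklore] -/
theorem norm_sq_eq_sum (ψ : Spins N) : ‖ψ‖ ^ 2 = ∑ σ, ‖ψ σ‖ ^ 2 := by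
  rw [EuclideanSpace.norm_eq, Real.sq_sqrt (Finset.sum_nonneg fun _ _ => by positivity)]

/-- Operator-norm bound for diagonal operators: `‖diagOp x s‖ ≤ M` if `‖s b‖ ≤ M`. [folklore] -/
theorem norm_diagOp_le (x : Fin N) {s : Bool → ℂ} {M : ℝ} (hM : 0 ≤ M) (hs : ∀ b, ‖s b‖ ≤ M) :
    ‖diagOp x s‖ ≤ M := by
  refine ContinuousLinearMap.opNorm_le_bound _ hM fun ψ => ?_
  have h2 : ‖diagOp x s ψ‖ ^ 2 ≤ (M * ‖ψ‖) ^ 2 := by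
    rw [norm_sq_eq_sum, mul_pow, norm_sq_eq_sum, Finset.mul_sum]
    refine Finset.sum_le_sum fun σ _ => ?_
    rw [diagOp_apply, norm_mul, mul_pow]
    gcongr
    exact hs _
  exact le_of_pow_le_pow_left₀ two_ne_zero (by positivity) h2

/-- Operator-norm bound for flip operators: `‖flipOp x a‖ ≤ M` if `‖a b‖ ≤ M`. [folklore] -/
theorem norm_flipOp_le (x : Fin N) {a : Bool → ℂ} {M : ℝ} (hM : 0 ≤ M) (ha : ∀ b, ‖a b‖ ≤ M) :
    ‖flipOp x a‖ ≤ M := by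
  refine ContinuousLinearMap.opNorm_le_bound _ hM fun ψ => ?_
  have h2 : ‖flipOp x a ψ‖ ^ 2 ≤ (M * ‖ψ‖) ^ 2 := by
    rw [norm_sq_eq_sum, mul_pow, norm_sq_eq_sum, Finset.mul_sum]
    rw [← Equiv.sum_comp (flipEquiv x) (fun σ => M ^ 2 * ‖ψ σ‖ ^ 2)]
    refine Finset.sum_le_sum fun σ _ => ?_
    rw [flipOp_apply, norm_mul, mul_pow, flipEquiv_apply]
    gcongr
    exact ha _
  exact le_of_pow_le_pow_left₀ two_ne_zero (by positivity) h2

/-! ### The spin operators and the vanishing-field Koma–Tasaki system -/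

/-- Symbol of `S^z`: `±1/2`. [folklore] -/
def szSym : Bool → ℂ := fun b => if b then 1 / 2 else -(1 / 2)

/-- Coefficient of `S^x = (S⁺ + S⁻)/2`: `1/2` on both target bits. [folklore] -/
def sxCoef : Bool → ℂ := fun _ => 1 / 2

/-- Coefficient of `S^y = (S⁺ − S⁻)/(2i)` read at the target bit: `⟨↑|S^y|↓⟩ = −i/2`, `⟨↓|S^y|↑⟩ = i/2`.
[folklore] -/
def syCoef : Bool → ℂ := fun b => if b then -(I / 2) else I / 2

/-- The `S^z` symbol is real. [folklore] -/
theorem conj_szSym (b : Bool) : conj (szSym b) = szSym b := by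
  have conj_two : conj (2 : ℂ) = 2 := Complex.conj_eq_iff_real.2 ⟨2, by norm_num⟩
  cases b <;> simp [szSym, conj_two]

/-- The `S^x` coefficient is real (and symmetric under bit flip). [folklore] -/
theorem conj_sxCoef (b : Bool) : conj (sxCoef b) = sxCoef (!b) := by
  have conj_two : conj (2 : ℂ) = 2 := Complex.conj_eq_iff_real.2 ⟨2, by norm_num⟩
  simp [sxCoef, conj_two]

/-- The `S^y` coefficient is conjugated by the bit flip: `conj (∓i/2) = ±i/2`. [folklore] -/
theorem conj_syCoef (b : Bool) : conj (syCoef b) = syCoef (!b) := by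
  have conj_two : conj (2 : ℂ) = 2 := Complex.conj_eq_iff_real.2 ⟨2, by norm_num⟩
  cases b <;> simp [syCoef, conj_two, neg_div]

/-- Norms of the symbols: all equal to `1/2`. [folklore] -/
theorem norm_szSym (b : Bool) : ‖szSym b‖ = 1 / 2 := by
  cases b <;> simp [szSym]

/-- Norm of the `S^x` coefficient. [folklore] -/
theorem norm_sxCoef (b : Bool) : ‖sxCoef b‖ = 1 / 2 := by
  simp [sxCoef]

/-- Norm of the `S^y` coefficient. [folklore] -/
theorem norm_syCoef (b : Bool) : ‖syCoef b‖ = 1 / 2 := by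
  cases b <;> simp [syCoef]

/-- `S^z_x`. [folklore] -/
def sz (x : Fin N) : Spins N →L[ℂ] Spins N := diagOp x szSym

/-- `S^x_x`. [folklore] -/
def sx (x : Fin N) : Spins N →L[ℂ] Spins N := flipOp x sxCoef

/-- `S^y_x`. [folklore] -/
def sy (x : Fin N) : Spins N →L[ℂ] Spins N := flipOp x syCoef

/-- Scalar multiples of flip operators are flip operators. [folklore] -/
theorem smul_flipOp (c : ℂ) (x : Fin N) (a : Bool → ℂ) :
    c • flipOp x a = flipOp x (fun b => c * a b) := by
  ext ψ σ
  rw [smul_apply, PiLp.smul_apply, flipOp_apply, flipOp_apply, smul_eq_mul]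
  ring

/-- Negatives of flip operators are flip operators. [folklore] -/
theorem neg_flipOp (x : Fin N) (a : Bool → ℂ) : -flipOp x a = flipOp x (fun b => -a b) := by
  ext ψ σ
  rw [neg_apply, PiLp.neg_apply, flipOp_apply, flipOp_apply]
  ring

/-- Scalar multiples of diagonal operators are diagonal operators. [folklore] -/
theorem smul_diagOp (c : ℂ) (x : Fin N) (s : Bool → ℂ) :
    c • diagOp x s = diagOp x (fun b => c * s b) := by
  ext ψ σ
  rw [smul_apply, PiLp.smul_apply, diagOp_apply, diagOp_apply, smul_eq_mul]
  ring

/-- On-site `su(2)` relation `[S^x, S^z] = −i S^y`. [folklore] -/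
theorem sx_mul_sz_sub (x : Fin N) : sx x * sz x - sz x * sx x = -(I • sy (N := N) x) := by
  rw [sx, sz, sy, flipOp_mul_diagOp_sub, smul_flipOp, neg_flipOp]
  congr 1
  funext b
  have hI : I * I = -1 := Complex.I_mul_I
  cases b
  · simp only [sxCoef, szSym, syCoef, Bool.not_false, if_true, if_false, Bool.false_eq_true]
    linear_combination (1 / 2 : ℂ) * hI
  · simp only [sxCoef, szSym, syCoef, Bool.not_true, if_true, if_false, Bool.false_eq_true]
    linear_combination (-1 / 2 : ℂ) * hI

/-- On-site `su(2)` relation `[S^y, S^z] = i S^x`. [folklore] -/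
theorem sy_mul_sz_sub (x : Fin N) : sy x * sz x - sz x * sy x = I • sx (N := N) x := by
  rw [sx, sz, sy, flipOp_mul_diagOp_sub, smul_flipOp]
  congr 1
  funext b
  cases b <;> simp only [sxCoef, szSym, syCoef, Bool.not_true, Bool.not_false, if_true, if_false,
    Bool.false_eq_true] <;> ring

/-- Commutator of a spin-flip component with the total `S^z`: only the own site contributes. [folklore] -/
theorem flipOp_comm_sum_sz (x : Fin N) (a : Bool → ℂ) :
    flipOp x a * (∑ y, sz y) - (∑ y, sz y) * flipOp x a = flipOp x a * sz x - sz x * flipOp x a := by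
  rw [Finset.mul_sum, Finset.sum_mul, ← Finset.sum_sub_distrib, Finset.sum_eq_single x]
  · intro y _ hyx
    rw [sz, flipOp_mul_diagOp_comm (Ne.symm hyx), sub_self]
  · intro hx; exact absurd (Finset.mem_univ x) hx

/-- **The vanishing-field spin system** as a Koma–Tasaki `U(1)` system on `Λ = Fin N`: local Hamiltonians
`h_x = N⁻¹ S^z_x` (a uniform field of strength `1/N`), order densities `o^{(1)}_x = S^x_x`, `o^{(2)}_x = S^y_x`,
charge `C = Σ_x S^z_x`, supports `S_x = {x}`, constants `r = 2`, `h = o = 1/2` INDEPENDENT of `N`.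
All of KT's hypotheses (2.12)–(2.14), i)–iii) hold. [cite: KomaTasaki1994, §2.3 (2.12)–(2.17) i)–iii)] -/
def spinSystem (N : ℕ) :
    Literature.MathematicalPhysics.QuantumLattice.KomaTasaki.U1System (Fin N) (Spins N) where
  h x := diagOp x (fun b => ((N : ℂ))⁻¹ * szSym b)
  o := ![sx, sy]
  C := ∑ x, sz x
  supp x := {x}
  r := 2
  hbar := 1 / 2
  obar := 1 / 2
  isSymmetric_h x := isSymmetric_diagOp x fun b => by
    rw [map_mul, conj_szSym, map_inv₀, Complex.conj_natCast]
  isSymmetric_o α x := by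
    fin_cases α
    · exact isSymmetric_flipOp x conj_sxCoef
    · exact isSymmetric_flipOp x conj_syCoef
  isSymmetric_C := by
    intro φ ψ
    simp only [ContinuousLinearMap.toLinearMap_sum, LinearMap.coe_sum, ContinuousLinearMap.coe_coe,
      Finset.sum_apply, sum_inner, inner_sum]
    exact Finset.sum_congr rfl fun x _ => isSymmetric_diagOp x conj_szSym φ ψ
  commute_hamiltonian_C :=
    Commute.sum_left _ _ _ fun x _ => Commute.sum_right _ _ _ fun y _ =>
      diagOp_mul_diagOp_comm x y _ _
  order_zero_C := by
    show (∑ x, sx x) * (∑ y, sz y) - (∑ y, sz y) * (∑ x, sx x) = -(I • ∑ x, sy x)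
    rw [Finset.sum_mul, Finset.mul_sum, ← Finset.sum_sub_distrib, Finset.smul_sum,
      ← Finset.sum_neg_distrib]
    refine Finset.sum_congr rfl fun x _ => ?_
    rw [sx, flipOp_comm_sum_sz, ← sx, sx_mul_sz_sub]
  order_one_C := by
    show (∑ x, sy x) * (∑ y, sz y) - (∑ y, sz y) * (∑ x, sy x) = I • ∑ x, sx x
    rw [Finset.sum_mul, Finset.mul_sum, ← Finset.sum_sub_distrib, Finset.smul_sum]
    refine Finset.sum_congr rfl fun x _ => ?_
    rw [sy, flipOp_comm_sum_sz, ← sy, sy_mul_sz_sub]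
  commute_o x y hxy α β := by
    fin_cases α <;> fin_cases β <;> exact flipOp_mul_flipOp_comm hxy _ _
  commute_h_o x y hy α := by
    have hxy : x ≠ y := fun h => hy (by simp [h])
    fin_cases α <;> exact (flipOp_mul_diagOp_comm (Ne.symm hxy) _ _).symm
  card_supp_le x := by simp
  two_le_r := le_rfl
  norm_h_le x := by
    refine norm_diagOp_le x (by norm_num) fun b => ?_
    rw [norm_mul, norm_inv, Complex.norm_natCast, norm_szSym]
    have hN : ((N : ℝ))⁻¹ ≤ 1 := Nat.cast_inv_le_one N
    calc ((N : ℝ))⁻¹ * (1 / 2) ≤ 1 * (1 / 2) := by gcongr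
      _ = 1 / 2 := one_mul _
  norm_o_le α x := by
    fin_cases α
    · exact norm_flipOp_le x (by norm_num) fun b => (norm_sxCoef b).le
    · exact norm_flipOp_le x (by norm_num) fun b => (norm_syCoef b).le
  obar_pos := by norm_num

/-! ### Counting up-spins -/

/-- Number of up spins of a configuration. [folklore] -/
def numUp (σ : Cfg N) : ℕ := (Finset.univ.filter fun x => σ x = true).card

/-- At most `N` up spins. [folklore] -/
theorem numUp_le (σ : Cfg N) : numUp σ ≤ N := by
  unfold numUp
  exact (Finset.card_filter_le _ _).trans (by simp)

/-- Number of down spins. [folklore] -/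
theorem card_filter_not (σ : Cfg N) :
    (Finset.univ.filter fun x => ¬ σ x = true).card = N - numUp σ := by
  have h := Finset.card_filter_add_card_filter_not (s := Finset.univ) (fun x => σ x = true)
  simp only [Finset.card_univ, Fintype.card_fin] at h
  unfold numUp
  omega

/-- A site-sum of a bit-dependent quantity. [folklore] -/
theorem sum_ite_bit (σ : Cfg N) (a b : ℂ) :
    ∑ x, (if σ x = true then a else b) = a * (numUp σ : ℂ) + b * ((N - numUp σ : ℕ) : ℂ) := by
  rw [Finset.sum_ite, Finset.sum_const, Finset.sum_const, ← card_filter_not, numUp]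
  simp [mul_comm]

/-- A configuration with an up site has at least one up spin. [folklore] -/
theorem one_le_numUp {σ : Cfg N} {x : Fin N} (hx : σ x = true) : 1 ≤ numUp σ := by
  unfold numUp
  exact Finset.card_pos.2 ⟨x, by simp [hx]⟩

/-- Flipping a spin changes the number of up spins by one. [folklore] -/
theorem numUp_flipAt (x : Fin N) (σ : Cfg N) :
    numUp (flipAt x σ) = if σ x = true then numUp σ - 1 else numUp σ + 1 := by
  unfold numUp
  by_cases hx : σ x = true
  · rw [if_pos hx]
    have : (Finset.univ.filter fun y => flipAt x σ y = true) =
        (Finset.univ.filter fun y => σ y = true).erase x := by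
      ext y
      by_cases hy : y = x
      · subst hy; simp [hx]
      · simp [hy, flipAt_apply_of_ne hy]
    rw [this, Finset.card_erase_of_mem (by simp [hx])]
  · rw [if_neg hx]
    have : (Finset.univ.filter fun y => flipAt x σ y = true) =
        insert x (Finset.univ.filter fun y => σ y = true) := by
      ext y
      by_cases hy : y = x
      · subst hy; simp [hx]
      · simp [hy, flipAt_apply_of_ne hy]
    rw [this, Finset.card_insert_of_notMem (by simp [hx])]

/-! ### The charge and the Hamiltonian in coordinates -/

/-- Magnetisation symbol `Σ_x s(σ_x) = numUp σ − N/2`. [folklore] -/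
theorem sum_szSym (σ : Cfg N) : ∑ x, szSym (σ x) = (numUp σ : ℂ) - (N : ℂ) / 2 := by
  have h : ∑ x, szSym (σ x) = ∑ x, (if σ x = true then (1 / 2 : ℂ) else -(1 / 2)) :=
    Finset.sum_congr rfl fun x _ => by unfold szSym; rfl
  rw [h, sum_ite_bit, Nat.cast_sub (numUp_le σ)]
  ring

/-- A sum of operators applied to a vector, in coordinates. [folklore] -/
theorem sum_clm_apply_apply {ι : Type*} (s : Finset ι) (T : ι → Spins N →L[ℂ] Spins N) (ψ : Spins N)
    (σ : Cfg N) : (∑ i ∈ s, T i) ψ σ = ∑ i ∈ s, T i ψ σ := by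
  rw [_root_.sum_apply, WithLp.ofLp_sum, Finset.sum_apply]

/-- The charge acts diagonally: `(C ψ)(σ) = (numUp σ − N/2) ψ(σ)`. [folklore] -/
theorem C_apply (ψ : Spins N) (σ : Cfg N) :
    (spinSystem N).C ψ σ = ((numUp σ : ℂ) - (N : ℂ) / 2) * ψ σ := by
  show (∑ x, sz x) ψ σ = _
  rw [sum_clm_apply_apply, ← sum_szSym, Finset.sum_mul]
  exact Finset.sum_congr rfl fun x _ => by rw [sz, diagOp_apply]

/-- The Hamiltonian is `N⁻¹ C`. [folklore] -/
theorem hamiltonian_apply (ψ : Spins N) (σ : Cfg N) :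
    (spinSystem N).hamiltonian ψ σ = ((N : ℂ))⁻¹ * ((numUp σ : ℂ) - (N : ℂ) / 2) * ψ σ := by
  show (∑ x, diagOp x (fun b => ((N : ℂ))⁻¹ * szSym b)) ψ σ = _
  rw [sum_clm_apply_apply, ← sum_szSym, Finset.mul_sum, Finset.sum_mul]
  exact Finset.sum_congr rfl fun x _ => by rw [diagOp_apply, mul_assoc]

/-- Energy expectation in coordinates. [folklore] -/
theorem inner_hamiltonian (ψ : Spins N) :
    ⟪ψ, (spinSystem N).hamiltonian ψ⟫_ℂ =
      ∑ σ, ((((N : ℝ))⁻¹ * ((numUp σ : ℝ) - (N : ℝ) / 2) * ‖ψ σ‖ ^ 2 : ℝ) : ℂ) := by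
  rw [inner_eq_sum]
  refine Finset.sum_congr rfl fun σ _ => ?_
  rw [hamiltonian_apply, ← mul_assoc, mul_comm (conj (ψ σ)), mul_assoc, mul_assoc,
    ← Complex.normSq_eq_conj_mul_self, Complex.normSq_eq_norm_sq]
  push_cast
  ring

/-- **Ground-energy bound:** `⟨ψ, H ψ⟩ ≥ −‖ψ‖²/2` (each configuration has `numUp ≥ 0`). [folklore] -/
theorem ground_energy_bound (hN : N ≠ 0) (ψ : Spins N) :
    -(1 / 2) * ‖ψ‖ ^ 2 ≤ (⟪ψ, (spinSystem N).hamiltonian ψ⟫_ℂ).re := by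
  rw [inner_hamiltonian]
  simp only [← Complex.ofReal_sum, Complex.ofReal_re]
  rw [norm_sq_eq_sum, Finset.mul_sum]
  refine Finset.sum_le_sum fun σ _ => ?_
  have hN' : (0 : ℝ) < N := by exact_mod_cast Nat.pos_of_ne_zero hN
  have h1 : -(1 / 2 : ℝ) ≤ ((N : ℝ))⁻¹ * ((numUp σ : ℝ) - (N : ℝ) / 2) := by
    have h2 : ((N : ℝ))⁻¹ * ((numUp σ : ℝ) - (N : ℝ) / 2) = (numUp σ : ℝ) / N - 1 / 2 := by
      field_simp
    rw [h2]
    have : (0 : ℝ) ≤ (numUp σ : ℝ) / N := by positivity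
    linarith
  exact mul_le_mul_of_nonneg_right h1 (by positivity)

/-! ### The ground state `|⇓⟩` -/

/-- The all-down configuration. [folklore] -/
def down : Cfg N := fun _ => false

/-- Basis vector of a configuration. [folklore] -/
def basisVec (τ : Cfg N) : Spins N := (WithLp.equiv 2 _).symm fun σ => if σ = τ then 1 else 0

/-- Coordinates of a basis vector. [folklore] -/
@[simp] theorem basisVec_apply (τ σ : Cfg N) : basisVec τ σ = if σ = τ then 1 else 0 := by
  simp [basisVec]

/-- The all-down configuration has no up spin. [folklore] -/
theorem numUp_down : numUp (down : Cfg N) = 0 := by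
  simp [numUp, down]

/-- Only the all-down configuration has no up spin. [folklore] -/
theorem numUp_eq_zero_iff (σ : Cfg N) : numUp σ = 0 ↔ σ = down := by
  constructor
  · intro h
    funext x
    have hx : x ∉ Finset.univ.filter fun y => σ y = true := by
      rw [numUp, Finset.card_eq_zero] at h
      simp [h]
    simpa [down] using hx
  · rintro rfl; exact numUp_down

/-- `|⇓⟩` is an eigenvector of `H` with eigenvalue `−1/2` (`N ≥ 1`). [folklore] -/
theorem hamiltonian_basisVec_down (hN : N ≠ 0) :
    (spinSystem N).hamiltonian (basisVec down) = ((-(1 / 2) : ℝ) : ℂ) • basisVec (down : Cfg N) := by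
  ext σ
  rw [hamiltonian_apply]
  show _ = ((-(1 / 2) : ℝ) : ℂ) * basisVec down σ
  rw [basisVec_apply]
  split_ifs with h
  · subst h
    rw [numUp_down]
    have : (N : ℂ) ≠ 0 := by exact_mod_cast hN
    field_simp
    push_cast
    ring
  · simp

/-- **Uniqueness of the ground state:** an eigenvector of `H` with eigenvalue `−1/2` is a multiple of `|⇓⟩`.
[folklore] -/
theorem eq_smul_basisVec_down_of_ground (hN : N ≠ 0) {g : Spins N}
    (hg : (spinSystem N).hamiltonian g = ((-(1 / 2) : ℝ) : ℂ) • g) : g = g down • basisVec down := by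
  ext σ
  show g σ = g down * basisVec down σ
  rw [basisVec_apply]
  by_cases hσ : σ = down
  · subst hσ; simp
  · rw [if_neg hσ, mul_zero]
    have h1 := congrArg (fun v : Spins N => v σ) hg
    simp only at h1
    rw [hamiltonian_apply] at h1
    change _ = ((-(1 / 2) : ℝ) : ℂ) * g σ at h1
    have hpos : 1 ≤ numUp σ := by
      by_contra h0
      exact hσ ((numUp_eq_zero_iff σ).1 (by omega))
    have hcoef : ((N : ℂ))⁻¹ * ((numUp σ : ℂ) - (N : ℂ) / 2) - ((-(1 / 2) : ℝ) : ℂ) ≠ 0 := by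
      have hNc : (N : ℂ) ≠ 0 := by exact_mod_cast hN
      have : ((N : ℂ))⁻¹ * ((numUp σ : ℂ) - (N : ℂ) / 2) - ((-(1 / 2) : ℝ) : ℂ) =
          (numUp σ : ℂ) / N := by
        field_simp; push_cast; ring
      rw [this]
      have : (numUp σ : ℂ) ≠ 0 := by exact_mod_cast (by omega : numUp σ ≠ 0)
      exact div_ne_zero this hNc
    have h2 : (((N : ℂ))⁻¹ * ((numUp σ : ℂ) - (N : ℂ) / 2) - ((-(1 / 2) : ℝ) : ℂ)) * g σ = 0 := by
      rw [sub_mul, h1, sub_self]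
    exact (mul_eq_zero.1 h2).resolve_left hcoef

/-- `O^{(1)} |⇓⟩ = ½ Σ_x |↑_x⟩`, in coordinates: the value at `σ` is `1/2` if `σ` has exactly the site `x` up
for some `x`, i.e. `(O^{(1)}|⇓⟩)(σ) = ½·[numUp σ = 1]`. [folklore] -/
theorem order_zero_basisVec_down_apply (σ : Cfg N) :
    (spinSystem N).order 0 (basisVec down) σ = if numUp σ = 1 then (1 / 2 : ℂ) else 0 := by
  show (∑ x, (![sx, sy] : Fin 2 → Fin N → Spins N →L[ℂ] Spins N) 0 x) (basisVec down) σ = _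
  simp only [Matrix.cons_val_zero]
  rw [sum_clm_apply_apply]
  simp only [sx, flipOp_apply, sxCoef, basisVec_apply, mul_ite, mul_one, mul_zero]
  rw [Finset.sum_ite, Finset.sum_const_zero, add_zero, Finset.sum_const, nsmul_eq_mul]
  have key : (Finset.univ.filter fun x => flipAt x σ = down).card = if numUp σ = 1 then 1 else 0 := by
    split_ifs with h1
    · obtain ⟨x, hx⟩ := Finset.card_eq_one.1 (show (Finset.univ.filter fun y => σ y = true).card = 1 from h1)
      rw [Finset.card_eq_one]
      refine ⟨x, ?_⟩
      ext y
      simp only [Finset.mem_filter, Finset.mem_univ, true_and, Finset.mem_singleton]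
      have hxT : σ x = true := by
        have : x ∈ Finset.univ.filter fun y => σ y = true := by rw [hx]; simp
        simpa using this
      have hoth : ∀ z, z ≠ x → σ z = false := by
        intro z hz
        by_contra hzT
        have : z ∈ Finset.univ.filter fun y => σ y = true := by simp [Bool.eq_true_of_not_eq_false hzT]  -- hmm
        rw [hx, Finset.mem_singleton] at this
        exact hz this
      constructor
      · intro hy
        by_contra hyx
        have := congr_fun hy x
        rw [flipAt_apply_of_ne (Ne.symm hyx) σ] at this
        simp [down, hxT] at this
      · rintro rfl
        funext z
        by_cases hz : z = y
        · subst hz; simp [down, hxT]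
        · rw [flipAt_apply_of_ne hz]; simp [down, hoth z hz]
    · rw [Finset.card_eq_zero, Finset.filter_eq_empty_iff]
      intro x _ hx
      apply h1
      have h2 := numUp_flipAt x σ
      rw [hx, numUp_down] at h2
      by_cases hb : σ x = true
      · rw [if_pos hb] at h2; have := one_le_numUp hb; omega
      · rw [if_neg hb] at h2; omega
  rw [key]
  split_ifs <;> simp

/-- **No long-range order on the ground floor:** `⟨⇓|(O^{(1)})²|⇓⟩ = N/4` (= `o²N`, not `≍ N²`).
[folklore] -/
theorem inner_order_zero_sq_basisVec_down :
    ⟪basisVec (down : Cfg N), (spinSystem N).order 0 ((spinSystem N).order 0 (basisVec down))⟫_ℂ =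
      (N : ℂ) / 4 := by
  have hs := (spinSystem N).isSymmetric_order 0 (basisVec down) ((spinSystem N).order 0 (basisVec down))
  simp only [ContinuousLinearMap.coe_coe] at hs
  rw [← hs, inner_eq_sum]
  simp only [order_zero_basisVec_down_apply]
  have : ∀ σ : Cfg N, conj (if numUp σ = 1 then (1 / 2 : ℂ) else 0) * (if numUp σ = 1 then (1 / 2 : ℂ) else 0)
      = if numUp σ = 1 then (1 / 4 : ℂ) else 0 := by
    have conj_two : conj (2 : ℂ) = 2 := Complex.conj_eq_iff_real.2 ⟨2, by norm_num⟩
    intro σ; split_ifs <;> simp [conj_two] ; norm_num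
  simp only [this]
  rw [Finset.sum_ite, Finset.sum_const_zero, add_zero, Finset.sum_const, nsmul_eq_mul]
  -- configurations with exactly one up spin: `N` of them
  have hcard : (Finset.univ.filter fun σ : Cfg N => numUp σ = 1).card = N := by
    have himg : (Finset.univ.filter fun σ : Cfg N => numUp σ = 1) =
        Finset.univ.image fun x : Fin N => flipAt x down := by
      ext σ
      simp only [Finset.mem_filter, Finset.mem_univ, true_and, Finset.mem_image]
      constructor
      · intro h1
        obtain ⟨x, hx⟩ := Finset.card_eq_one.1 (show (Finset.univ.filter fun y => σ y = true).card = 1 from h1)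
        refine ⟨x, ?_⟩
        funext z
        by_cases hz : z = x
        · subst hz
          have : z ∈ Finset.univ.filter fun y => σ y = true := by rw [hx]; simp
          simpa [down] using (show σ z = true by simpa using this).symm
        · rw [flipAt_apply_of_ne hz]
          have : z ∉ Finset.univ.filter fun y => σ y = true := by rw [hx]; simpa using hz
          simp only [Finset.mem_filter, Finset.mem_univ, true_and, Bool.not_eq_true] at this
          simp [down, this]
      · rintro ⟨x, rfl⟩
        rw [numUp_flipAt, numUp_down]
        simp [down]
    rw [himg, Finset.card_image_of_injective _ fun x y hxy => ?_]
    · simp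
    · by_contra hne
      have := congr_fun hxy x
      rw [flipAt_apply_same, flipAt_apply_of_ne hne] at this
      simp [down] at this
  rw [hcard]
  ring

/-! ### The symmetry-broken trial state `|⇒⟩` (all spins along `+x`) -/

/-- The all-ones vector `Σ_σ |σ⟩ = 2^{N/2} |⇒⟩`. [folklore] -/
def ones : Spins N := (WithLp.equiv 2 _).symm fun _ => 1

/-- Coordinates of the all-ones vector. [folklore] -/
@[simp] theorem ones_apply (σ : Cfg N) : (ones : Spins N) σ = 1 := by simp [ones]

/-- The all-ones vector is nonzero. [folklore] -/
theorem ones_ne_zero : (ones : Spins N) ≠ 0 := by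
  intro h
  have := congrArg (fun v : Spins N => v down) h
  simp at this

/-- Global spin flip (complement of a configuration). [folklore] -/
def complEquiv : Cfg N ≃ Cfg N where
  toFun σ := fun y => !σ y
  invFun σ := fun y => !σ y
  left_inv σ := by funext y; simp
  right_inv σ := by funext y; simp

/-- The global flip exchanges up and down counts. [folklore] -/
theorem numUp_complEquiv (σ : Cfg N) : numUp (complEquiv σ) = N - numUp σ := by
  rw [← card_filter_not]
  unfold numUp complEquiv
  congr 1
  ext y
  simp

/-- `|⇒⟩` is an eigenvector of `O^{(1)}` with the maximal eigenvalue `N/2`. [folklore] -/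
theorem order_zero_ones : (spinSystem N).order 0 ones = ((N : ℂ) / 2) • (ones : Spins N) := by
  ext σ
  show (∑ x, (![sx, sy] : Fin 2 → Fin N → Spins N →L[ℂ] Spins N) 0 x) ones σ = (N : ℂ) / 2 * ones σ
  simp only [Matrix.cons_val_zero]
  rw [sum_clm_apply_apply]
  simp [sx, sxCoef]
  ring

/-- `|⇒⟩` has zero energy: `⟨⇒|H|⇒⟩ = 0` (pair `σ` with its flip at any fixed site). [folklore] -/
theorem inner_hamiltonian_ones : ⟪(ones : Spins N), (spinSystem N).hamiltonian ones⟫_ℂ = 0 := by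
  rw [inner_eq_sum]
  simp only [hamiltonian_apply, ones_apply, map_one, one_mul, mul_one]
  rw [← Finset.mul_sum]
  suffices h : ∑ σ : Cfg N, ((numUp σ : ℂ) - (N : ℂ) / 2) = 0 by rw [h, mul_zero]
  have hflip : ∑ σ : Cfg N, ((numUp σ : ℂ) - (N : ℂ) / 2) =
      ∑ σ : Cfg N, -((numUp σ : ℂ) - (N : ℂ) / 2) := by
    rw [← Equiv.sum_comp complEquiv]
    refine Finset.sum_congr rfl fun σ _ => ?_
    rw [numUp_complEquiv, Nat.cast_sub (numUp_le σ)]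
    ring
  have h2 : 2 * ∑ σ : Cfg N, ((numUp σ : ℂ) - (N : ℂ) / 2) = 0 := by
    rw [two_mul]
    nth_rewrite 2 [hflip]
    rw [Finset.sum_neg_distrib, add_neg_cancel]
  exact (mul_eq_zero.1 h2).resolve_left two_ne_zero

/-! ### The low-lying LRO eigenstate: the Dicke vector of the `C = 0` sector -/

/-- Unnormalised Dicke vector: the indicator of the configurations with exactly `k` up spins. [folklore] -/
def dicke (k : ℕ) : Spins N := (WithLp.equiv 2 _).symm fun σ => if numUp σ = k then 1 else 0

/-- Coordinates of a Dicke vector. [folklore] -/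
@[simp] theorem dicke_apply (k : ℕ) (σ : Cfg N) : (dicke k : Spins N) σ = if numUp σ = k then 1 else 0 := by
  simp [dicke]

/-- Number of configurations with `k` up spins (`= N.choose k`, not needed). [folklore] -/
def countUp (N k : ℕ) : ℕ := (Finset.univ.filter fun σ : Cfg N => numUp σ = k).card

/-- Dicke vectors are charge eigenvectors: `C d_k = (k − N/2) d_k`. [folklore] -/
theorem C_dicke (k : ℕ) : (spinSystem N).C (dicke k) = ((k : ℂ) - (N : ℂ) / 2) • (dicke k : Spins N) := by
  ext σ
  show _ = ((k : ℂ) - (N : ℂ) / 2) * dicke k σ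
  rw [C_apply, dicke_apply]
  split_ifs with h
  · rw [h]
  · simp

/-- Dicke vectors are energy eigenvectors: `H d_k = N⁻¹(k − N/2) d_k`. [folklore] -/
theorem hamiltonian_dicke (k : ℕ) :
    (spinSystem N).hamiltonian (dicke k) = (((N : ℂ))⁻¹ * ((k : ℂ) - (N : ℂ) / 2)) • (dicke k : Spins N) := by
  ext σ
  show _ = (((N : ℂ))⁻¹ * ((k : ℂ) - (N : ℂ) / 2)) * dicke k σ
  rw [hamiltonian_apply, dicke_apply]
  split_ifs with h
  · rw [h]
  · simp

/-- Distinct Dicke vectors are orthogonal (disjoint supports). [folklore] -/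
theorem inner_dicke_dicke_of_ne {j k : ℕ} (h : j ≠ k) : ⟪(dicke j : Spins N), dicke k⟫_ℂ = 0 := by
  rw [inner_eq_sum]
  refine Finset.sum_eq_zero fun σ _ => ?_
  rw [dicke_apply, dicke_apply]
  split_ifs with h1 h2 <;> simp
  exact h (h1.symm.trans h2)

/-- `⟨d_k, d_k⟩ = countUp N k`. [folklore] -/
theorem inner_dicke_self (k : ℕ) : ⟪(dicke k : Spins N), dicke k⟫_ℂ = (countUp N k : ℂ) := by
  rw [inner_eq_sum, countUp, Finset.card_eq_sum_ones, Nat.cast_sum, Finset.sum_filter]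
  refine Finset.sum_congr rfl fun σ _ => ?_
  rw [dicke_apply]
  split_ifs <;> simp

/-- `‖d_k‖² = countUp N k`. [folklore] -/
theorem norm_dicke_sq (k : ℕ) : ‖(dicke k : Spins N)‖ ^ 2 = countUp N k := by
  rw [norm_sq_eq_sum, countUp, Finset.card_eq_sum_ones, Nat.cast_sum, Finset.sum_filter]
  refine Finset.sum_congr rfl fun σ _ => ?_
  rw [dicke_apply]
  split_ifs <;> simp

/-- `|{i : Fin N | i < m}| = m` for `m ≤ N`. [folklore] -/
theorem card_filter_val_lt {m : ℕ} (hm : m ≤ N) : (Finset.univ.filter fun i : Fin N => (i : ℕ) < m).card = m := by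
  rw [← Finset.card_map Fin.valEmbedding]
  have : (Finset.univ.filter fun i : Fin N => (i : ℕ) < m).map Fin.valEmbedding = Finset.range m := by
    ext j
    simp only [Finset.mem_map, Finset.mem_filter, Finset.mem_univ, true_and, Fin.valEmbedding_apply,
      Finset.mem_range]
    exact ⟨fun ⟨i, hi, hij⟩ => hij ▸ hi, fun hj => ⟨⟨j, lt_of_lt_of_le hj hm⟩, hj, rfl⟩⟩
  rw [this, Finset.card_range]

/-- Dicke vectors with `k ≤ N` are nonzero. [folklore] -/
theorem countUp_pos {k : ℕ} (hk : k ≤ N) : 0 < countUp N k := by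
  refine Finset.card_pos.2 ⟨fun i => decide ((i : ℕ) < k), ?_⟩
  simp only [Finset.mem_filter, Finset.mem_univ, true_and, numUp]
  convert card_filter_val_lt hk using 2
  ext i
  simp

/-- **The ladder identity.** For a uniform flip field `A = Σ_x flipOp x a` and `1 ≤ k`:
`A d_k = a(↑)(k+1) d_{k+1} + a(↓)(N−k+1) d_{k−1}` (a configuration with `k+1` ups is reached from `k+1`
configurations with `k` ups by raising, one with `k−1` ups from `N−k+1` by lowering). [folklore] -/
theorem sum_flipOp_dicke (a : Bool → ℂ) {k : ℕ} (hk : 1 ≤ k) :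
    (∑ x, flipOp x a) (dicke k : Spins N) =
      (a true * ((k : ℂ) + 1)) • dicke (k + 1) + (a false * ((N : ℂ) - k + 1)) • dicke (k - 1) := by
  ext τ
  rw [sum_clm_apply_apply]
  show ∑ x, flipOp x a (dicke k) τ =
    a true * ((k : ℂ) + 1) * dicke (k + 1) τ + a false * ((N : ℂ) - k + 1) * dicke (k - 1) τ
  simp only [flipOp_apply, dicke_apply, numUp_flipAt]
  have step : ∀ x, a (τ x) * (if (if τ x = true then numUp τ - 1 else numUp τ + 1) = k then (1 : ℂ) else 0)
      = if τ x = true then (if numUp τ = k + 1 then a true else 0)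
        else (if numUp τ + 1 = k then a false else 0) := by
    intro x
    by_cases hb : τ x = true
    · simp only [hb, if_true]
      by_cases h1 : numUp τ = k + 1
      · rw [if_pos (by omega), if_pos h1, mul_one]
      · have h1' : ¬ (numUp τ - 1 = k) := by have := one_le_numUp hb; omega
        rw [if_neg h1', if_neg h1, mul_zero]
    · have hb' : τ x = false := by simpa using hb
      simp only [hb', Bool.false_eq_true, if_false]
      by_cases h1 : numUp τ + 1 = k
      · rw [if_pos h1, if_pos h1, mul_one]
      · rw [if_neg h1, if_neg h1, mul_zero]
  rw [Finset.sum_congr rfl fun x _ => step x, Finset.sum_ite, Finset.sum_const, Finset.sum_const,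
    card_filter_not, nsmul_eq_mul, nsmul_eq_mul, Nat.cast_sub (numUp_le τ)]
  change (numUp τ : ℂ) * _ + _ = _
  by_cases hA : numUp τ = k + 1
  · have hB : ¬ (numUp τ + 1 = k) := by omega
    have hC : ¬ (numUp τ = k - 1) := by omega
    rw [if_pos hA, if_neg hB, if_pos hA, if_neg hC, hA]
    push_cast; ring
  · by_cases hB : numUp τ + 1 = k
    · have hC : numUp τ = k - 1 := by omega
      rw [if_neg hA, if_pos hB, if_neg hA, if_pos hC]
      have : (k : ℂ) = numUp τ + 1 := by rw [← hB]; push_cast; ring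
      rw [this]; ring
    · have hC : ¬ (numUp τ = k - 1) := by omega
      rw [if_neg hA, if_neg hB, if_neg hA, if_neg hC]
      ring

/-- The first order operator is the uniform flip field with coefficient `sxCoef`. [folklore] -/
theorem order_zero_eq : (spinSystem N).order 0 = ∑ x, flipOp x sxCoef := rfl

/-- The second order operator is the uniform flip field with coefficient `syCoef`. [folklore] -/
theorem order_one_eq : (spinSystem N).order 1 = ∑ x, flipOp x syCoef := rfl

/-! ### Half filling: `N = 2m`, the `C = 0` Dicke vector `D = d_m` -/

section HalfFilling

variable {m : ℕ}

/-- The ladder identity at half filling: both neighbours receive the coefficient `m + 1`. [folklore] -/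
theorem sum_flipOp_dicke_half (a : Bool → ℂ) (hm : 1 ≤ m) :
    (∑ x, flipOp x a) (dicke m : Spins (2 * m)) =
      (a true * ((m : ℂ) + 1)) • dicke (m + 1) + (a false * ((m : ℂ) + 1)) • dicke (m - 1) := by
  rw [sum_flipOp_dicke a hm]
  congr 2
  push_cast
  ring

/-- Gram computation for a combination of the two neighbouring Dicke vectors. [folklore] -/
theorem inner_dicke_pair (c₁ c₂ : ℂ) (hm : 1 ≤ m) :
    ⟪(c₁ • dicke (m + 1) + c₂ • dicke (m - 1) : Spins (2 * m)),
        c₁ • dicke (m + 1) + c₂ • dicke (m - 1)⟫_ℂ =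
      ((‖c₁‖ ^ 2 * countUp (2 * m) (m + 1) + ‖c₂‖ ^ 2 * countUp (2 * m) (m - 1) : ℝ) : ℂ) := by
  have hne : m + 1 ≠ m - 1 := by omega
  simp only [inner_add_left, inner_add_right, inner_smul_left, inner_smul_right, inner_dicke_self,
    inner_dicke_dicke_of_ne hne, inner_dicke_dicke_of_ne (Ne.symm hne), mul_zero, add_zero, zero_add]
  rw [← mul_assoc, ← mul_assoc, Complex.mul_conj', Complex.mul_conj']
  push_cast
  ring

/-- **The binomial identity `(m+1)·#{σ : numUp σ = m+1} = m·#{σ : numUp σ = m}` on `2m` sites**, proved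
without binomial coefficients: evaluate `⟨O^{(1)} d_m, d_{m+1}⟩ = ⟨d_m, O^{(1)} d_{m+1}⟩` (symmetry of
`O^{(1)}`) with the ladder identity on both sides. [folklore] -/
theorem succ_mul_countUp_succ (hm : 1 ≤ m) :
    ((m : ℝ) + 1) * countUp (2 * m) (m + 1) = m * countUp (2 * m) m := by
  have hs := (spinSystem (2 * m)).isSymmetric_order 0 (dicke m) (dicke (m + 1))
  simp only [ContinuousLinearMap.coe_coe] at hs
  rw [order_zero_eq, sum_flipOp_dicke_half sxCoef hm, sum_flipOp_dicke sxCoef (by omega : 1 ≤ m + 1)] at hs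
  have hne1 : m - 1 ≠ m + 1 := by omega
  have hne2 : m ≠ m + 1 + 1 := by omega
  have hsub : m + 1 - 1 = m := by omega
  have conj_two : conj (2 : ℂ) = 2 := Complex.conj_eq_iff_real.2 ⟨2, by norm_num⟩
  simp only [hsub, inner_add_left, inner_add_right, inner_smul_left, inner_smul_right, inner_dicke_self,
    inner_dicke_dicke_of_ne hne1, inner_dicke_dicke_of_ne hne2, mul_zero, add_zero, zero_add, sxCoef,
    map_mul, map_div₀, map_one, conj_two, map_add, map_natCast] at hs
  -- hs : 1/2 * (m+1) * n_{m+1} = 1/2 * ((2m) - (m+1) + 1) * n_m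
  have hs' : ((m : ℂ) + 1) * countUp (2 * m) (m + 1) = m * countUp (2 * m) m := by
    have := hs
    push_cast at this
    linear_combination (2 : ℂ) * this
  exact_mod_cast hs'

/-- Nonvanishing of the half-filled Dicke vector. [folklore] -/
theorem dicke_half_ne_zero : (dicke m : Spins (2 * m)) ≠ 0 := by
  intro h
  have h1 := norm_dicke_sq (N := 2 * m) m
  rw [h, norm_zero] at h1
  have h2 := countUp_pos (N := 2 * m) (k := m) (by omega)
  have : (countUp (2 * m) m : ℝ) = 0 := by rw [← h1]; norm_num
  exact absurd (by exact_mod_cast this) h2.ne'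

/-- **Long-range order of the Dicke vector:** `⟨D, (O^{(1)})² D⟩ ≥ (m/2)² ‖D‖²` on `N = 2m` sites, i.e.
KT's hypothesis (2.17) with `μ o N = ½·½·2m`. [folklore] -/
theorem lro_dicke_half (hm : 1 ≤ m) :
    ((m : ℝ) / 2) ^ 2 * ‖(dicke m : Spins (2 * m))‖ ^ 2 ≤
      (⟪(dicke m : Spins (2 * m)),
        (spinSystem (2 * m)).order 0 ((spinSystem (2 * m)).order 0 (dicke m))⟫_ℂ).re := by
  have hs := (spinSystem (2 * m)).isSymmetric_order 0 (dicke m) ((spinSystem (2 * m)).order 0 (dicke m))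
  simp only [ContinuousLinearMap.coe_coe] at hs
  rw [← hs, order_zero_eq, sum_flipOp_dicke_half sxCoef hm, inner_dicke_pair _ _ hm, Complex.ofReal_re]
  simp only [sxCoef, norm_mul, norm_div, norm_one, Complex.norm_ofNat]
  have hn : ‖((m : ℂ) + 1)‖ = (m : ℝ) + 1 := by
    rw [show ((m : ℂ) + 1) = (((m : ℝ) + 1 : ℝ) : ℂ) by push_cast; ring, Complex.norm_real, Real.norm_eq_abs,
      abs_of_nonneg (by positivity)]
  rw [hn, norm_dicke_sq]
  have hid := succ_mul_countUp_succ hm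
  have h0 : (0 : ℝ) ≤ countUp (2 * m) (m - 1) := by positivity
  have h1 : (0 : ℝ) ≤ countUp (2 * m) m := by positivity
  have hm1 : (1 : ℝ) ≤ m := by exact_mod_cast hm
  nlinarith [hid, h0, h1, hm1]

/-- The two order operators have the same mean square in the Dicke vector (KT (2.17), second part).
[folklore] -/
theorem lro_eq_dicke_half (hm : 1 ≤ m) :
    ⟪(dicke m : Spins (2 * m)), (spinSystem (2 * m)).order 0 ((spinSystem (2 * m)).order 0 (dicke m))⟫_ℂ =
      ⟪(dicke m : Spins (2 * m)), (spinSystem (2 * m)).order 1 ((spinSystem (2 * m)).order 1 (dicke m))⟫_ℂ := by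
  have hs0 := (spinSystem (2 * m)).isSymmetric_order 0 (dicke m) ((spinSystem (2 * m)).order 0 (dicke m))
  have hs1 := (spinSystem (2 * m)).isSymmetric_order 1 (dicke m) ((spinSystem (2 * m)).order 1 (dicke m))
  simp only [ContinuousLinearMap.coe_coe] at hs0 hs1
  rw [← hs0, ← hs1, order_zero_eq, order_one_eq, sum_flipOp_dicke_half sxCoef hm,
    sum_flipOp_dicke_half syCoef hm, inner_dicke_pair _ _ hm, inner_dicke_pair _ _ hm]
  simp [sxCoef, syCoef, norm_neg, Complex.norm_I]

/-- The normalised half-filled Dicke vector. [folklore] -/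
def dickeState (m : ℕ) : Spins (2 * m) := ((‖(dicke m : Spins (2 * m))‖⁻¹ : ℝ) : ℂ) • dicke m

/-- The Dicke state is normalised. [folklore] -/
theorem norm_dickeState : ‖dickeState m‖ = 1 := by
  rw [dickeState, norm_smul, Complex.norm_real, norm_inv, norm_norm,
    inv_mul_cancel₀ (norm_ne_zero_iff.2 dicke_half_ne_zero)]

/-- **The Dicke state is an LRO eigenstate in the exact sense of Koma–Tasaki's hypothesis iv)** — a
normalised simultaneous eigenvector of `H` (eigenvalue `0`, i.e. excitation energy `1/2` above the ground
energy `−1/2`) and of `C` (eigenvalue `0`) with `⟨(O^{(1)})²⟩ = ⟨(O^{(2)})²⟩ ≥ (μ o N)²`, `μ = 1/2`.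
[cite: KomaTasaki1994, §2.3 iv) (2.17)] -/
theorem isLROEigenstate_dickeState (hm : 1 ≤ m) :
    Literature.MathematicalPhysics.QuantumLattice.KomaTasaki.IsLROEigenstate (spinSystem (2 * m))
      (dickeState m) 0 (1 / 2) where
  norm_eq_one := norm_dickeState
  eigen_hamiltonian := by
    rw [dickeState, map_smul, hamiltonian_dicke]
    have : ((2 * m : ℕ) : ℂ)⁻¹ * ((m : ℂ) - ((2 * m : ℕ) : ℂ) / 2) = 0 := by push_cast; ring
    rw [this, zero_smul, smul_zero, Complex.ofReal_zero, zero_smul]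
  eigen_C := ⟨0, by
    rw [dickeState, map_smul, C_dicke]
    have : ((m : ℂ) - ((2 * m : ℕ) : ℂ) / 2) = 0 := by push_cast; ring
    rw [this, zero_smul, smul_zero, zero_smul]⟩
  mu_pos := by norm_num
  mu_le_one := by norm_num
  lro := by
    rw [dickeState, map_smul, map_smul, inner_smul_left, inner_smul_right, ← mul_assoc, Complex.conj_ofReal,
      ← Complex.ofReal_mul, Complex.re_ofReal_mul]
    have hD : (0 : ℝ) < ‖(dicke m : Spins (2 * m))‖ := norm_pos_iff.2 dicke_half_ne_zero
    have hl := lro_dicke_half hm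
    have hcard : (Fintype.card (Fin (2 * m)) : ℝ) = 2 * m := by simp
    rw [hcard, show (spinSystem (2 * m)).obar = 1 / 2 from rfl]
    have hD0 : ‖(dicke m : Spins (2 * m))‖ ≠ 0 := hD.ne'
    have : (1 / 2 * (1 / 2) * (2 * (m : ℝ))) ^ 2 = ‖(dicke m : Spins (2 * m))‖⁻¹ * ‖(dicke m : Spins (2 * m))‖⁻¹ *
        (((m : ℝ) / 2) ^ 2 * ‖(dicke m : Spins (2 * m))‖ ^ 2) := by
      calc (1 / 2 * (1 / 2) * (2 * (m : ℝ))) ^ 2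
          = ((m : ℝ) / 2) ^ 2 * (‖(dicke m : Spins (2 * m))‖⁻¹ * ‖(dicke m : Spins (2 * m))‖) ^ 2 := by
            rw [inv_mul_cancel₀ hD0]; ring
        _ = _ := by ring
    rw [this]
    exact mul_le_mul_of_nonneg_left hl (by positivity)
  lro_eq := by
    rw [dickeState, map_smul, map_smul, map_smul, map_smul, inner_smul_left, inner_smul_right, inner_smul_left,
      inner_smul_right, lro_eq_dicke_half hm]

end HalfFilling

/-! ### Summary theorem -/

/-- **Koma–Tasaki-class witness (vanishing-field spins).**  For every `m ≥ 1`, on `N = 2m` sites, the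
`U(1)` system `spinSystem N` satisfies all of Koma–Tasaki's structural hypotheses with the `N`-independent
constants `h = o = 1/2`, `r = 2`, and:
(1) its ground energy is `−1/2` (`⟨ψ, Hψ⟩ ≥ −‖ψ‖²/2`), attained, and EVERY ground state is a multiple of `|⇓⟩`
    and has `⟨(O^{(1)})²⟩ = (N/4)‖g‖²` — no long-range order (`o²N`, not `(μ o N)²`);
(2) the normalised `C = 0` Dicke vector is an LRO eigenstate in KT's exact sense iv) (`IsLROEigenstate`, `μ = 1/2`)
    with energy `0`, i.e. a LOW-LYING eigenstate at excitation energy exactly `1/2` (zero excess energy DENSITY);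
(3) the product vector `|⇒⟩` has `⟨H⟩ = 0` and `O^{(1)}|⇒⟩ = (N/2)|⇒⟩`, so under the symmetry-breaking field
    `−B O^{(1)}` the ground energy drops at least linearly, `E_N(B) ≤ −BN/2 = E_N(0) − (BN/2 − 1/2)`, with the
    volume threshold `N ≥ 1/B` depending on `B` — symmetry breaking "after the thermodynamic limit" while the
    symmetric floor is order-free at every `N`.
So the transfer "order under an infinitesimal field / at vanishing excess energy density ⇒ long-range order of the
finite-volume ground states" is not a consequence of the Koma–Tasaki axioms with uniform constants: it needs an
input that distinguishes a volume-independent interaction, which is what the barrier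
`SourcedOrderWithoutGroundStateLRO` records as unavailable in print. [cite: KomaTasaki1994, §2.3 and §2.5]
[cite: LiebSeiringerYngvason2007, §3] -/
theorem komaTasakiClass_lowLyingLRO_without_groundStateLRO (m : ℕ) (hm : 1 ≤ m) :
    (spinSystem (2 * m)).hbar = 1 / 2 ∧ (spinSystem (2 * m)).obar = 1 / 2 ∧ (spinSystem (2 * m)).r = 2 ∧
    (∀ ψ : Spins (2 * m), -(1 / 2) * ‖ψ‖ ^ 2 ≤ (⟪ψ, (spinSystem (2 * m)).hamiltonian ψ⟫_ℂ).re) ∧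
    (∀ g : Spins (2 * m), (spinSystem (2 * m)).hamiltonian g = ((-(1 / 2) : ℝ) : ℂ) • g →
      g = g down • basisVec down ∧
      ⟪g, (spinSystem (2 * m)).order 0 ((spinSystem (2 * m)).order 0 g)⟫_ℂ =
        (((2 * m : ℕ) : ℂ) / 4) * ((‖g‖ ^ 2 : ℝ) : ℂ)) ∧
    (∃ g : Spins (2 * m), g ≠ 0 ∧ (spinSystem (2 * m)).hamiltonian g = ((-(1 / 2) : ℝ) : ℂ) • g) ∧
    (∃ Φ : Spins (2 * m),
      Literature.MathematicalPhysics.QuantumLattice.KomaTasaki.IsLROEigenstate (spinSystem (2 * m)) Φ 0 (1 / 2) ∧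
      (spinSystem (2 * m)).C Φ = 0) ∧
    (∃ u : Spins (2 * m), u ≠ 0 ∧ ⟪u, (spinSystem (2 * m)).hamiltonian u⟫_ℂ = 0 ∧
      (spinSystem (2 * m)).order 0 u = (((2 * m : ℕ) : ℂ) / 2) • u) := by
  have hN : 2 * m ≠ 0 := by omega
  refine ⟨rfl, rfl, rfl, ground_energy_bound hN, fun g hg => ?_, ?_, ?_, ?_⟩
  · have hg' := eq_smul_basisVec_down_of_ground hN hg
    refine ⟨hg', ?_⟩
    rw [hg', map_smul, map_smul, inner_smul_left, inner_smul_right, inner_order_zero_sq_basisVec_down,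
      norm_smul, mul_pow]
    have hb : ‖(basisVec (down : Cfg (2 * m)) : Spins (2 * m))‖ = 1 := by
      have h2 : ‖(basisVec (down : Cfg (2 * m)) : Spins (2 * m))‖ ^ 2 = 1 := by
        rw [norm_sq_eq_sum, Finset.sum_eq_single down]
        · simp
        · intro σ _ hσ; simp [hσ]
        · simp
      have h3 : 0 ≤ ‖(basisVec (down : Cfg (2 * m)) : Spins (2 * m))‖ := norm_nonneg _
      nlinarith
    rw [hb, ← mul_assoc, Complex.conj_mul']
    push_cast
    ring
  · exact ⟨basisVec down, fun h => by simpa using congrArg (fun v : Spins (2 * m) => v down) h,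
      hamiltonian_basisVec_down hN⟩
  · refine ⟨dickeState m, isLROEigenstate_dickeState hm, ?_⟩
    rw [dickeState, map_smul, C_dicke]
    have : ((m : ℂ) - ((2 * m : ℕ) : ℂ) / 2) = 0 := by push_cast; ring
    rw [this, zero_smul, smul_zero]
  · exact ⟨ones, ones_ne_zero, inner_hamiltonian_ones, order_zero_ones⟩

end VanishingFieldSpins

end Literature.Barriers.HubbardSuperconductivity
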